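import Summits.AtomisticToContinuum.Crystallization.Theorems.ChartedPlanarOrderLayerFrame

/-!
# ChartedPlanarOrder — W_far analytic bricks: Gram coordinate floors and summable planar lattice sums

decomp-a2c lens-3 (generation 23/24; N = `Theses.ChartedPlanarOrder.ChartedZeroExcessLayered`, PS column; toward the analytic
W_far `…TubeMonotoneSplit.FarPairStiffnessL1`, design-neutral real analysis).

* §1 Gram coordinate floors: `‖α a + β b‖² ‖b‖² ≥ α² G`, `‖α a + β b‖² ‖a‖² ≥ β² G` (`G = ‖a‖²‖b‖² − ⟪a,b⟫²`), and the SITE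
  FLOOR `‖v + (i a + j b)‖² ≥ ⟪ν,v⟫² + ((i + c₁)² G/‖b‖² + (j + c₂)² G/‖a‖²)/2` when the planar part of `v` is `c₁ a + c₂ b`.
* §2 one-dimensional sums: `Σ_{i ∈ ℤ} ((p + q (i + c)²)²)⁻¹ < ∞` for `p, q > 0` (comparison with `((1 + i²)²)⁻¹ ≤ 4 (i+1)⁻⁴`).
* §3 planar site sums: `Σ_{(i,j) ∈ ℤ²} ((t² + q₁(i + c₁)² + q₂(j + c₂)²)⁴)⁻¹ < ∞` by the PRODUCT TRICK
  `((X + Y + Z)⁴)⁻¹ ≤ ((X/2 + Y)²)⁻¹ ((X/2 + Z)²)⁻¹`, and the exponent-7 companion; with `r⁻⁸ = (r²)⁻⁴`, `r⁻¹⁴ = (r²)⁻⁷`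
  this makes the per-site pair-force moduli `15 r⁻¹⁴ + 9 r⁻⁸` (`…PairForceLipschitz`) summable over a layer.
-/

open scoped RealInnerProductSpace
open Summit.AtomisticToContinuum.Crystallization.Theorems.ChartedPlanarOrderRigidityDoor (E3)
open Summit.AtomisticToContinuum.Crystallization.Theorems.ChartedPlanarOrderLayerFrame (norm_sq_eq_planar_add_height)

namespace Summit.AtomisticToContinuum.Crystallization.Theorems.ChartedPlanarOrderPlanarLatticeSums

/-! ## §1 Gram coordinate floors -/

/-- the Gram determinant of `(α a + β b, b)` is `α²` times that of `(a, b)`. -/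
theorem gram_smul_add (a b : E3) (α β : ℝ) :
    ‖α • a + β • b‖ ^ 2 * ‖b‖ ^ 2 - ⟪α • a + β • b, b⟫ ^ 2 = α ^ 2 * (‖a‖ ^ 2 * ‖b‖ ^ 2 - ⟪a, b⟫ ^ 2) := by
  have h1 : ‖α • a + β • b‖ ^ 2 = α ^ 2 * ‖a‖ ^ 2 + 2 * (α * β * ⟪a, b⟫) + β ^ 2 * ‖b‖ ^ 2 := by
    rw [norm_add_sq_real, real_inner_smul_left, real_inner_smul_right, norm_smul, norm_smul, Real.norm_eq_abs,
      Real.norm_eq_abs, mul_pow, mul_pow, sq_abs, sq_abs]; ring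
  have h2 : ⟪α • a + β • b, b⟫ = α * ⟪a, b⟫ + β * ‖b‖ ^ 2 := by
    rw [inner_add_left, real_inner_smul_left, real_inner_smul_left, real_inner_self_eq_norm_sq]
  rw [h1, h2]; ring

/-- coordinate floor along `a`: `α² G ≤ ‖α a + β b‖² ‖b‖²`. -/
theorem coord_sq_mul_gram_le (a b : E3) (α β : ℝ) :
    α ^ 2 * (‖a‖ ^ 2 * ‖b‖ ^ 2 - ⟪a, b⟫ ^ 2) ≤ ‖α • a + β • b‖ ^ 2 * ‖b‖ ^ 2 := by
  rw [← gram_smul_add]; linarith [sq_nonneg ⟪α • a + β • b, b⟫]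

/-- coordinate floor along `b`: `β² G ≤ ‖α a + β b‖² ‖a‖²`. -/
theorem coord_sq_mul_gram_le' (a b : E3) (α β : ℝ) :
    β ^ 2 * (‖a‖ ^ 2 * ‖b‖ ^ 2 - ⟪a, b⟫ ^ 2) ≤ ‖α • a + β • b‖ ^ 2 * ‖a‖ ^ 2 := by
  have h := coord_sq_mul_gram_le b a β α
  rw [add_comm (β • b), real_inner_comm a b] at h
  calc β ^ 2 * (‖a‖ ^ 2 * ‖b‖ ^ 2 - ⟪a, b⟫ ^ 2) = β ^ 2 * (‖b‖ ^ 2 * ‖a‖ ^ 2 - ⟪a, b⟫ ^ 2) := by ring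
    _ ≤ ‖α • a + β • b‖ ^ 2 * ‖a‖ ^ 2 := h

/-- ★ SITE FLOOR: if the planar part of `v` is `c₁ a + c₂ b`, the lattice site `v + (i a + j b)` has
`‖·‖² ≥ ⟪ν,v⟫² + ((i + c₁)² G/‖b‖² + (j + c₂)² G/‖a‖²)/2`. -/
theorem norm_sq_site_ge {ν a b v : E3} {c₁ c₂ : ℝ} (hν : ‖ν‖ = 1) (ha : ⟪ν, a⟫ = 0) (hb : ⟪ν, b⟫ = 0) (ha0 : a ≠ 0)
    (hb0 : b ≠ 0) (hv : v - ⟪ν, v⟫ • ν = c₁ • a + c₂ • b) (i j : ℤ) :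
    ⟪ν, v⟫ ^ 2 + ((‖a‖ ^ 2 * ‖b‖ ^ 2 - ⟪a, b⟫ ^ 2) / ‖b‖ ^ 2 * ((i : ℝ) + c₁) ^ 2 +
      (‖a‖ ^ 2 * ‖b‖ ^ 2 - ⟪a, b⟫ ^ 2) / ‖a‖ ^ 2 * ((j : ℝ) + c₂) ^ 2) / 2 ≤ ‖v + ((i : ℝ) • a + (j : ℝ) • b)‖ ^ 2 := by
  have hx : ⟪ν, v + ((i : ℝ) • a + (j : ℝ) • b)⟫ = ⟪ν, v⟫ := by
    rw [inner_add_right, inner_add_right, inner_smul_right, inner_smul_right, ha, hb]; ring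
  obtain ⟨_, hdec⟩ := norm_sq_eq_planar_add_height hν (v + ((i : ℝ) • a + (j : ℝ) • b))
  have hp : v + ((i : ℝ) • a + (j : ℝ) • b) - ⟪ν, v + ((i : ℝ) • a + (j : ℝ) • b)⟫ • ν =
      ((i : ℝ) + c₁) • a + ((j : ℝ) + c₂) • b := by
    rw [hx, show v + ((i : ℝ) • a + (j : ℝ) • b) - ⟪ν, v⟫ • ν = (v - ⟪ν, v⟫ • ν) + ((i : ℝ) • a + (j : ℝ) • b) by abel,
      hv, add_smul, add_smul]; abel
  rw [hp, hx] at hdec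
  have hA := coord_sq_mul_gram_le a b ((i : ℝ) + c₁) ((j : ℝ) + c₂)
  have hB := coord_sq_mul_gram_le' a b ((i : ℝ) + c₁) ((j : ℝ) + c₂)
  have ha2 : 0 < ‖a‖ ^ 2 := by positivity
  have hb2 : 0 < ‖b‖ ^ 2 := by positivity
  have hA' : (‖a‖ ^ 2 * ‖b‖ ^ 2 - ⟪a, b⟫ ^ 2) / ‖b‖ ^ 2 * ((i : ℝ) + c₁) ^ 2 ≤
      ‖((i : ℝ) + c₁) • a + ((j : ℝ) + c₂) • b‖ ^ 2 := by
    rw [div_mul_eq_mul_div, div_le_iff₀ hb2]; linarith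
  have hB' : (‖a‖ ^ 2 * ‖b‖ ^ 2 - ⟪a, b⟫ ^ 2) / ‖a‖ ^ 2 * ((j : ℝ) + c₂) ^ 2 ≤
      ‖((i : ℝ) + c₁) • a + ((j : ℝ) + c₂) • b‖ ^ 2 := by
    rw [div_mul_eq_mul_div, div_le_iff₀ ha2]; linarith
  rw [hdec]; linarith

/-! ## §2 One-dimensional sums -/

/-- `Σ_{i ∈ ℤ} ((1 + i²)²)⁻¹ < ∞`. -/
theorem summable_inv_one_add_sq_sq : Summable fun i : ℤ => ((1 + (i : ℝ) ^ 2) ^ 2)⁻¹ := by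
  have hnat : Summable fun n : ℕ => ((1 + (n : ℝ) ^ 2) ^ 2)⁻¹ := by
    have hs : Summable fun n : ℕ => 4 * (1 / ((n + 1 : ℕ) : ℝ) ^ 4) :=
      ((summable_nat_add_iff 1).2 (Real.summable_one_div_nat_pow.2 (by norm_num : 1 < 4))).mul_left 4
    refine Summable.of_nonneg_of_le (fun n => by positivity) (fun n => ?_) hs
    have h1 : ((n : ℝ) + 1) ^ 2 ≤ 2 * (1 + (n : ℝ) ^ 2) := by nlinarith [sq_nonneg ((n : ℝ) - 1)]
    have h2 : (((n : ℝ) + 1) ^ 2) ^ 2 ≤ (2 * (1 + (n : ℝ) ^ 2)) ^ 2 := pow_le_pow_left₀ (by positivity) h1 2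
    push_cast
    rw [inv_eq_one_div, mul_one_div, div_le_div_iff₀ (by positivity) (by positivity)]
    nlinarith [h2]
  refine summable_int_iff_summable_nat_and_neg.2 ⟨by exact_mod_cast hnat, ?_⟩
  simpa using hnat

/-- ★ `Σ_{i ∈ ℤ} ((p + q (i + c)²)²)⁻¹ < ∞` for `p, q > 0`. -/
theorem summable_inv_quad_sq {p q : ℝ} (hp : 0 < p) (hq : 0 < q) (c : ℝ) :
    Summable fun i : ℤ => ((p + q * ((i : ℝ) + c) ^ 2) ^ 2)⁻¹ := by
  have hm : 0 < min p q := lt_min hp hq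
  have hc : 0 < 1 + c ^ 2 := by positivity
  refine Summable.of_nonneg_of_le (fun i => by positivity) (fun i => ?_)
    (summable_inv_one_add_sq_sq.mul_left ((2 * (1 + c ^ 2) / min p q) ^ 2))
  have hi : 0 < 1 + (i : ℝ) ^ 2 := by positivity
  have hu : 1 + (i : ℝ) ^ 2 ≤ 2 * (1 + c ^ 2) * (1 + ((i : ℝ) + c) ^ 2) := by
    nlinarith [sq_nonneg (c * ((i : ℝ) + c)), sq_nonneg ((i : ℝ) + c + c)]
  have hR : min p q * (1 + ((i : ℝ) + c) ^ 2) ≤ p + q * ((i : ℝ) + c) ^ 2 := by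
    nlinarith [min_le_left p q, min_le_right p q, sq_nonneg ((i : ℝ) + c)]
  have hL : 0 < min p q * (1 + (i : ℝ) ^ 2) / (2 * (1 + c ^ 2)) := by positivity
  have hLR : min p q * (1 + (i : ℝ) ^ 2) / (2 * (1 + c ^ 2)) ≤ p + q * ((i : ℝ) + c) ^ 2 := by
    rw [div_le_iff₀ (by positivity)]; nlinarith [hm.le]
  have h := inv_anti₀ (pow_pos hL 2) (pow_le_pow_left₀ hL.le hLR 2)
  have e : ((min p q * (1 + (i : ℝ) ^ 2) / (2 * (1 + c ^ 2))) ^ 2)⁻¹ =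
      (2 * (1 + c ^ 2) / min p q) ^ 2 * ((1 + (i : ℝ) ^ 2) ^ 2)⁻¹ := by
    field_simp
  rw [e] at h; exact h

/-! ## §3 Planar site sums -/

/-- the product trick: `((X + Y + Z)⁴)⁻¹ ≤ ((X/2 + Y)²)⁻¹ · ((X/2 + Z)²)⁻¹` for `X > 0`, `Y, Z ≥ 0`. -/
theorem inv_pow_four_le_prod {X Y Z : ℝ} (hX : 0 < X) (hY : 0 ≤ Y) (hZ : 0 ≤ Z) :
    ((X + Y + Z) ^ 4)⁻¹ ≤ ((X / 2 + Y) ^ 2)⁻¹ * ((X / 2 + Z) ^ 2)⁻¹ := by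
  have hu : 0 < X / 2 + Y := by positivity
  have hv : 0 < X / 2 + Z := by positivity
  have huv : (X / 2 + Y) * (X / 2 + Z) ≤ (X + Y + Z) ^ 2 := by nlinarith [mul_pos hu hv]
  rw [← mul_inv, ← mul_pow, show (X + Y + Z) ^ 4 = ((X + Y + Z) ^ 2) ^ 2 by ring]
  exact inv_anti₀ (by positivity) (pow_le_pow_left₀ (by positivity) huv 2)

/-- ★ PLANAR SITE SUM: `Σ_{(i,j)} ((t² + q₁ (i + c₁)² + q₂ (j + c₂)²)⁴)⁻¹ < ∞`. -/
theorem summable_sites_four {t q₁ q₂ : ℝ} (ht : 0 < t) (hq₁ : 0 < q₁) (hq₂ : 0 < q₂) (c₁ c₂ : ℝ) :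
    Summable fun ij : ℤ × ℤ => ((t ^ 2 + q₁ * ((ij.1 : ℝ) + c₁) ^ 2 + q₂ * ((ij.2 : ℝ) + c₂) ^ 2) ^ 4)⁻¹ := by
  have ht2 : 0 < t ^ 2 / 2 := by positivity
  have hprod := (summable_inv_quad_sq ht2 hq₁ c₁).mul_of_nonneg (summable_inv_quad_sq ht2 hq₂ c₂)
    (fun i => by positivity) (fun j => by positivity)
  refine Summable.of_nonneg_of_le (fun ij => by positivity) (fun ij => ?_) hprod
  have h := inv_pow_four_le_prod (X := t ^ 2) (Y := q₁ * ((ij.1 : ℝ) + c₁) ^ 2) (Z := q₂ * ((ij.2 : ℝ) + c₂) ^ 2)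
    (by positivity) (by positivity) (by positivity)
  simpa only [show t ^ 2 / 2 = t ^ 2 / 2 from rfl] using h

/-- the exponent-7 companion: `((t² + A + B)⁷)⁻¹ ≤ (t²)⁻³ · ((t² + A + B)⁴)⁻¹`. -/
theorem inv_pow_seven_le {t A B : ℝ} (ht : 0 < t) (hA : 0 ≤ A) (hB : 0 ≤ B) :
    ((t ^ 2 + A + B) ^ 7)⁻¹ ≤ ((t ^ 2) ^ 3)⁻¹ * ((t ^ 2 + A + B) ^ 4)⁻¹ := by
  have hS : t ^ 2 ≤ t ^ 2 + A + B := by linarith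
  rw [← mul_inv, show (t ^ 2 + A + B) ^ 7 = (t ^ 2 + A + B) ^ 3 * (t ^ 2 + A + B) ^ 4 by ring]
  exact inv_anti₀ (by positivity) (mul_le_mul_of_nonneg_right (pow_le_pow_left₀ (by positivity) hS 3) (by positivity))

/-- ★ PLANAR SITE SUM, exponent 7. -/
theorem summable_sites_seven {t q₁ q₂ : ℝ} (ht : 0 < t) (hq₁ : 0 < q₁) (hq₂ : 0 < q₂) (c₁ c₂ : ℝ) :
    Summable fun ij : ℤ × ℤ => ((t ^ 2 + q₁ * ((ij.1 : ℝ) + c₁) ^ 2 + q₂ * ((ij.2 : ℝ) + c₂) ^ 2) ^ 7)⁻¹ :=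
  Summable.of_nonneg_of_le (fun ij => by positivity) (fun ij => inv_pow_seven_le ht (by positivity) (by positivity))
    ((summable_sites_four ht hq₁ hq₂ c₁ c₂).mul_left _)

/-- even inverse powers of a square root: `(√S)⁻¹ ^ (2n) = (Sⁿ)⁻¹` for `S ≥ 0`. -/
theorem inv_sqrt_pow_two_mul {S : ℝ} (hS : 0 ≤ S) (n : ℕ) : (Real.sqrt S)⁻¹ ^ (2 * n) = (S ^ n)⁻¹ := by
  rw [inv_pow, pow_mul, Real.sq_sqrt hS]

/-- ★ the per-site pair-force moduli `15 r⁻¹⁴ + 9 r⁻⁸` at the floors `r = √(t² + q₁(i + c₁)² + q₂(j + c₂)²)` are summable. -/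
theorem summable_modulus_sites {t q₁ q₂ : ℝ} (ht : 0 < t) (hq₁ : 0 < q₁) (hq₂ : 0 < q₂) (c₁ c₂ : ℝ) :
    Summable fun ij : ℤ × ℤ =>
      15 * (Real.sqrt (t ^ 2 + q₁ * ((ij.1 : ℝ) + c₁) ^ 2 + q₂ * ((ij.2 : ℝ) + c₂) ^ 2))⁻¹ ^ 14 +
      9 * (Real.sqrt (t ^ 2 + q₁ * ((ij.1 : ℝ) + c₁) ^ 2 + q₂ * ((ij.2 : ℝ) + c₂) ^ 2))⁻¹ ^ 8 := by
  have h14 : ∀ ij : ℤ × ℤ, (Real.sqrt (t ^ 2 + q₁ * ((ij.1 : ℝ) + c₁) ^ 2 + q₂ * ((ij.2 : ℝ) + c₂) ^ 2))⁻¹ ^ 14 =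
      ((t ^ 2 + q₁ * ((ij.1 : ℝ) + c₁) ^ 2 + q₂ * ((ij.2 : ℝ) + c₂) ^ 2) ^ 7)⁻¹ := fun ij =>
    inv_sqrt_pow_two_mul (by positivity) 7
  have h8 : ∀ ij : ℤ × ℤ, (Real.sqrt (t ^ 2 + q₁ * ((ij.1 : ℝ) + c₁) ^ 2 + q₂ * ((ij.2 : ℝ) + c₂) ^ 2))⁻¹ ^ 8 =
      ((t ^ 2 + q₁ * ((ij.1 : ℝ) + c₁) ^ 2 + q₂ * ((ij.2 : ℝ) + c₂) ^ 2) ^ 4)⁻¹ := fun ij =>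
    inv_sqrt_pow_two_mul (by positivity) 4
  simp_rw [h14, h8]
  exact ((summable_sites_seven ht hq₁ hq₂ c₁ c₂).mul_left 15).add ((summable_sites_four ht hq₁ hq₂ c₁ c₂).mul_left 9)

end Summit.AtomisticToContinuum.Crystallization.Theorems.ChartedPlanarOrderPlanarLatticeSums
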